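import Mathlib.Analysis.InnerProductSpace.PiL2
import Mathlib.Analysis.Calculus.MeanValue
import Mathlib.Analysis.Calculus.ContDiff.Defs
import Literature.Geometry.Lorentzian.Basic

/-!
# Route EIHFluxBalance — crux `InertialRecession` (E′), line `SketchCleanExcision`:
# the staircase, part 2 — kinematics and the isolation scale

Helper file for the crux `stmt-FinalStateConjecture-17403`
(`Summit.FinalStateConjecture.FinalStateConjecture.Theses.EIHFluxBalance.InertialRecession`), registered stub
`stub_integratedClusterBalance` (skeleton r12, `Cruxes/InertialRecession/Lines/SketchCleanExcision.lean`).

* `exists_kinematicTime`: the late-time kinematic package of the abstract expanding system (cone `‖ξᵢ‖ ≤ κ²s`,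
  speeds `≤ 2` hence `2`-Lipschitz centres, all mutual distances `≥ 1`), from the endgame hypotheses.
* `isol⟦ξ, c₀, S, s⟧` — the ISOLATION SCALE of a member set `S` at time `s`: the minimum of `c₀ s` and of all
  distances between a member and a non-member (a `Finset.fold min`, total also when `S` has no outsiders);
  `gsc⟦ξ, c₀, s⟧` — the same over all pairs (the scale handed to the threshold `ρ`). One-sided Lipschitz bounds along a
  step (`isol_le_isol_add`, `isol_sub_le_isol`), the comparison `gsc ≤ isol`, the floor `min (c₀ s) 1 ≤ isol`,
  and `gsc → ∞`.
Mathlib only. [folklore]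
-/

noncomputable section

set_option linter.dupNamespace false

open scoped BigOperators Classical Topology
open Finset Filter

namespace Summit.FinalStateConjecture.FinalStateConjecture.Theorems.SublinearIsFree.Staircase

open Literature.Geometry.Lorentzian


variable {N : ℕ}

/-! ### Late-time kinematics -/

/-- A differentiable curve with speed `≤ 2` after `T` is `2`-Lipschitz after `T`. [folklore] -/
theorem norm_sub_le_two_mul {f : ℝ → E3} (hd : Differentiable ℝ f) {T : ℝ} (hb : ∀ t, T ≤ t → ‖deriv f t‖ ≤ 2)
    {s s' : ℝ} (hs : T ≤ s) (hs' : T ≤ s') : ‖f s - f s'‖ ≤ 2 * |s - s'| := by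
  have key : ∀ a b, T ≤ a → a ≤ b → ‖f b - f a‖ ≤ 2 * |b - a| := by
    intro a b ha hab
    have := Convex.norm_image_sub_le_of_norm_deriv_le (𝕜 := ℝ) (s := Set.Ici a) (fun x _ ↦ hd.differentiableAt)
      (fun x hx ↦ hb x (ha.trans hx)) (convex_Ici a) (Set.self_mem_Ici) (Set.mem_Ici.mpr hab)
    simpa using this
  rcases le_total s s' with h | h
  · rw [norm_sub_rev, abs_sub_comm]
    exact key s s' hs h
  · exact key s' s hs' h

/-- **Late-time kinematic package.** From the endgame hypotheses: a time `T ≥ 1` after which every centre is in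
the cone `‖ξᵢ s‖ ≤ κ²s`, has speed `≤ 2`, and all mutual distances are `≥ 1`. [folklore] -/
theorem exists_kinematicTime (ξ v : Fin N → ℝ → E3) (κ : ℝ)
    (hsm : ∀ i, ContDiff ℝ ((⊤ : ℕ∞) : WithTop ℕ∞) (ξ i)) (hcone : ∀ i, ∀ᶠ t in atTop, ‖ξ i t‖ ≤ κ ^ 2 * t)
    (hsep : ∀ i j, i ≠ j → Tendsto (fun t ↦ ‖ξ i t - ξ j t‖) atTop atTop)
    (hk : ∃ k : ℝ, 0 ≤ k ∧ k < 1 ∧ ∀ i t, ‖v i t‖ ≤ k)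
    (hmis : ∀ i, Tendsto (fun t ↦ deriv (ξ i) t - v i t) atTop (𝓝 0)) :
    ∃ T : ℝ, 1 ≤ T ∧ (∀ i s, T ≤ s → ‖ξ i s‖ ≤ κ ^ 2 * s) ∧ (∀ i s, T ≤ s → ‖deriv (ξ i) s‖ ≤ 2) ∧
      (∀ i j s, i ≠ j → T ≤ s → 1 ≤ ‖ξ i s - ξ j s‖) ∧
      (∀ i s s', T ≤ s → T ≤ s' → ‖ξ i s - ξ i s'‖ ≤ 2 * |s - s'|) := by
  obtain ⟨k, hk0, hk1, hkb⟩ := hk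
  have h1 : ∀ᶠ t in atTop, ∀ i, ‖ξ i t‖ ≤ κ ^ 2 * t := eventually_all.mpr hcone
  have h2 : ∀ᶠ t in atTop, ∀ i, ‖deriv (ξ i) t‖ ≤ 2 := by
    refine eventually_all.mpr fun i ↦ ?_
    have := (hmis i).norm
    rw [norm_zero] at this
    filter_upwards [this.eventually (gt_mem_nhds one_pos)] with t ht
    calc ‖deriv (ξ i) t‖ = ‖(deriv (ξ i) t - v i t) + v i t‖ := by rw [sub_add_cancel]
      _ ≤ ‖deriv (ξ i) t - v i t‖ + ‖v i t‖ := norm_add_le _ _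
      _ ≤ 1 + k := add_le_add ht.le (hkb i t)
      _ ≤ 2 := by linarith
  have h3 : ∀ᶠ t in atTop, ∀ i j, i ≠ j → 1 ≤ ‖ξ i t - ξ j t‖ := by
    refine eventually_all.mpr fun i ↦ eventually_all.mpr fun j ↦ ?_
    by_cases hij : i = j
    · exact Eventually.of_forall fun _ h ↦ (h hij).elim
    · filter_upwards [(hsep i j hij).eventually_ge_atTop 1] with t ht _ using ht
  obtain ⟨T, hT⟩ := ((h1.and (h2.and h3)).and (eventually_ge_atTop 1)).exists_forall_of_atTop
  refine ⟨T, (hT T le_rfl).2, fun i s hs ↦ (hT s hs).1.1 i, fun i s hs ↦ (hT s hs).1.2.1 i,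
    fun i j s hij hs ↦ (hT s hs).1.2.2 i j hij, fun i s s' hs hs' ↦ ?_⟩
  exact norm_sub_le_two_mul ((hsm i).differentiable (by simp)) (fun t ht ↦ (hT t ht).1.2.1 i) hs hs'

/-! ### The isolation scale -/

section Isol

variable {ξ : Fin N → ℝ → E3} {c₀ : ℝ} {S : Finset (Fin N)} {s : ℝ}

/-- Lower bounds of the isolation scale. [folklore] -/
theorem le_isol_iff {c : ℝ} : c ≤ (Finset.fold min (c₀ * s) (fun pp ↦ ‖ξ (Prod.fst pp) s - ξ (Prod.snd pp) s‖) (S ×ˢ Sᶜ)) ↔ c ≤ c₀ * s ∧ ∀ i ∈ S, ∀ j ∉ S, c ≤ ‖ξ i s - ξ j s‖ := by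
  rw [Finset.le_fold_min]
  constructor
  · rintro ⟨h1, h2⟩
    exact ⟨h1, fun i hi j hj ↦ h2 (i, j) (Finset.mem_product.mpr ⟨hi, Finset.mem_compl.mpr hj⟩)⟩
  · rintro ⟨h1, h2⟩
    refine ⟨h1, fun p hp ↦ ?_⟩
    obtain ⟨hp1, hp2⟩ := Finset.mem_product.mp hp
    exact h2 p.1 hp1 p.2 (Finset.mem_compl.mp hp2)

/-- The isolation scale is at most `c₀ s`. [folklore] -/
theorem isol_le : (Finset.fold min (c₀ * s) (fun pp ↦ ‖ξ (Prod.fst pp) s - ξ (Prod.snd pp) s‖) (S ×ˢ Sᶜ)) ≤ c₀ * s :=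
  (Finset.fold_min_le _).mpr (Or.inl le_rfl)

/-- The isolation scale is at most every member/non-member distance. [folklore] -/
theorem isol_le_norm_sub {i j : Fin N} (hi : i ∈ S) (hj : j ∉ S) : (Finset.fold min (c₀ * s) (fun pp ↦ ‖ξ (Prod.fst pp) s - ξ (Prod.snd pp) s‖) (S ×ˢ Sᶜ)) ≤ ‖ξ i s - ξ j s‖ :=
  (Finset.fold_min_le _).mpr (Or.inr ⟨(i, j), Finset.mem_product.mpr ⟨hi, Finset.mem_compl.mpr hj⟩, le_rfl⟩)

/-- Lower bounds of the global scale. [folklore] -/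
theorem le_gsc_iff {c : ℝ} : c ≤ (Finset.fold min (c₀ * s) (fun pp ↦ ‖ξ (Prod.fst pp) s - ξ (Prod.snd pp) s‖) (Finset.offDiag Finset.univ)) ↔ c ≤ c₀ * s ∧ ∀ i j, i ≠ j → c ≤ ‖ξ i s - ξ j s‖ := by
  rw [Finset.le_fold_min]
  constructor
  · rintro ⟨h1, h2⟩
    exact ⟨h1, fun i j hij ↦ h2 (i, j) (Finset.mem_offDiag.mpr ⟨Finset.mem_univ _, Finset.mem_univ _, hij⟩)⟩
  · rintro ⟨h1, h2⟩
    refine ⟨h1, fun p hp ↦ ?_⟩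
    exact h2 p.1 p.2 (Finset.mem_offDiag.mp hp).2.2

/-- The global scale is below every isolation scale. [folklore] -/
theorem gsc_le_isol : (Finset.fold min (c₀ * s) (fun pp ↦ ‖ξ (Prod.fst pp) s - ξ (Prod.snd pp) s‖) (Finset.offDiag Finset.univ)) ≤ (Finset.fold min (c₀ * s) (fun pp ↦ ‖ξ (Prod.fst pp) s - ξ (Prod.snd pp) s‖) (S ×ˢ Sᶜ)) := by
  rw [le_isol_iff]
  refine ⟨(Finset.fold_min_le _).mpr (Or.inl le_rfl), fun i hi j hj ↦ ?_⟩
  have hij : i ≠ j := fun h ↦ hj (h ▸ hi)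
  exact (Finset.fold_min_le _).mpr
    (Or.inr ⟨(i, j), Finset.mem_offDiag.mpr ⟨Finset.mem_univ _, Finset.mem_univ _, hij⟩, le_rfl⟩)

/-- Floor: if all mutual distances are `≥ 1` then `min (c₀ s) 1 ≤ isol`. [folklore] -/
theorem min_le_isol (h : ∀ i j, i ≠ j → 1 ≤ ‖ξ i s - ξ j s‖) : min (c₀ * s) 1 ≤ (Finset.fold min (c₀ * s) (fun pp ↦ ‖ξ (Prod.fst pp) s - ξ (Prod.snd pp) s‖) (S ×ˢ Sᶜ)) := by
  rw [le_isol_iff]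
  refine ⟨min_le_left _ _, fun i hi j hj ↦ (min_le_right _ _).trans (h i j fun h' ↦ hj (h' ▸ hi))⟩

/-- One-sided Lipschitz bound (upper): along `[s, s']` with `2`-Lipschitz centres and `0 ≤ c₀ ≤ 4`,
`isol s' ≤ isol s + 4 (s' − s)`. [folklore] -/
theorem isol_le_isol_add {s' : ℝ} (hss' : s ≤ s') (hc₄ : c₀ ≤ 4)
    (hlip : ∀ i, ‖ξ i s - ξ i s'‖ ≤ 2 * |s - s'|) :
    (Finset.fold min (c₀ * s') (fun pp ↦ ‖ξ (Prod.fst pp) s' - ξ (Prod.snd pp) s'‖) (S ×ˢ Sᶜ)) ≤ (Finset.fold min (c₀ * s) (fun pp ↦ ‖ξ (Prod.fst pp) s - ξ (Prod.snd pp) s‖) (S ×ˢ Sᶜ)) + 4 * (s' - s) := by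
  have habs : |s - s'| = s' - s := by rw [abs_sub_comm, abs_of_nonneg (by linarith)]
  suffices h : (Finset.fold min (c₀ * s') (fun pp ↦ ‖ξ (Prod.fst pp) s' - ξ (Prod.snd pp) s'‖) (S ×ˢ Sᶜ)) - 4 * (s' - s) ≤ (Finset.fold min (c₀ * s) (fun pp ↦ ‖ξ (Prod.fst pp) s - ξ (Prod.snd pp) s‖) (S ×ˢ Sᶜ)) by linarith
  rw [le_isol_iff]
  constructor
  · have := isol_le (ξ := ξ) (c₀ := c₀) (S := S) (s := s')
    nlinarith [mul_le_mul_of_nonneg_right hc₄ (sub_nonneg.mpr hss')]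
  · intro i hi j hj
    have h1 := isol_le_norm_sub (ξ := ξ) (c₀ := c₀) (s := s') hi hj
    have h2 : ‖ξ i s' - ξ j s'‖ ≤ ‖ξ i s - ξ j s‖ + 4 * (s' - s) := by
      calc ‖ξ i s' - ξ j s'‖ = ‖(ξ i s - ξ j s) - ((ξ i s - ξ i s') - (ξ j s - ξ j s'))‖ := by congr 1; abel
        _ ≤ ‖ξ i s - ξ j s‖ + ‖(ξ i s - ξ i s') - (ξ j s - ξ j s')‖ := norm_sub_le _ _
        _ ≤ ‖ξ i s - ξ j s‖ + (‖ξ i s - ξ i s'‖ + ‖ξ j s - ξ j s'‖) := by gcongr; exact norm_sub_le _ _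
        _ ≤ ‖ξ i s - ξ j s‖ + (2 * |s - s'| + 2 * |s - s'|) := by gcongr <;> exact hlip _
        _ = _ := by rw [habs]; ring
    linarith

/-- One-sided Lipschitz bound (lower): `isol s − 4 (s' − s) ≤ isol s'`. [folklore] -/
theorem isol_sub_le_isol {s' : ℝ} (hss' : s ≤ s') (hc₀ : 0 ≤ c₀)
    (hlip : ∀ i, ‖ξ i s - ξ i s'‖ ≤ 2 * |s - s'|) :
    (Finset.fold min (c₀ * s) (fun pp ↦ ‖ξ (Prod.fst pp) s - ξ (Prod.snd pp) s‖) (S ×ˢ Sᶜ)) - 4 * (s' - s) ≤ (Finset.fold min (c₀ * s') (fun pp ↦ ‖ξ (Prod.fst pp) s' - ξ (Prod.snd pp) s'‖) (S ×ˢ Sᶜ)) := by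
  have habs : |s - s'| = s' - s := by rw [abs_sub_comm, abs_of_nonneg (by linarith)]
  rw [le_isol_iff]
  constructor
  · have := isol_le (ξ := ξ) (c₀ := c₀) (S := S) (s := s)
    nlinarith [mul_le_mul_of_nonneg_left hss' hc₀]
  · intro i hi j hj
    have h1 := isol_le_norm_sub (ξ := ξ) (c₀ := c₀) (s := s) hi hj
    have h2 : ‖ξ i s - ξ j s‖ ≤ ‖ξ i s' - ξ j s'‖ + 4 * (s' - s) := by
      calc ‖ξ i s - ξ j s‖ = ‖(ξ i s' - ξ j s') + ((ξ i s - ξ i s') - (ξ j s - ξ j s'))‖ := by congr 1; abel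
        _ ≤ ‖ξ i s' - ξ j s'‖ + ‖(ξ i s - ξ i s') - (ξ j s - ξ j s')‖ := norm_add_le _ _
        _ ≤ ‖ξ i s' - ξ j s'‖ + (‖ξ i s - ξ i s'‖ + ‖ξ j s - ξ j s'‖) := by gcongr; exact norm_sub_le _ _
        _ ≤ ‖ξ i s' - ξ j s'‖ + (2 * |s - s'| + 2 * |s - s'|) := by gcongr <;> exact hlip _
        _ = _ := by rw [habs]; ring
    linarith

/-- The global scale tends to infinity (pairwise separation, `c₀ > 0`). [folklore] -/
theorem tendsto_gsc (hc₀ : 0 < c₀) (hsep : ∀ i j, i ≠ j → Tendsto (fun t ↦ ‖ξ i t - ξ j t‖) atTop atTop) :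
    Tendsto (fun s ↦ (Finset.fold min (c₀ * s) (fun pp ↦ ‖ξ (Prod.fst pp) s - ξ (Prod.snd pp) s‖) (Finset.offDiag Finset.univ))) atTop atTop := by
  refine tendsto_atTop.mpr fun b ↦ ?_
  have h1 : ∀ᶠ t in atTop, b ≤ c₀ * t := by
    filter_upwards [eventually_ge_atTop (b / c₀)] with t ht
    rwa [div_le_iff₀ hc₀, mul_comm] at ht
  have h2 : ∀ᶠ t in atTop, ∀ i j, i ≠ j → b ≤ ‖ξ i t - ξ j t‖ := by
    refine eventually_all.mpr fun i ↦ eventually_all.mpr fun j ↦ ?_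
    by_cases hij : i = j
    · exact Eventually.of_forall fun _ h ↦ (h hij).elim
    · filter_upwards [(hsep i j hij).eventually_ge_atTop b] with t ht _ using ht
  filter_upwards [h1, h2] with t ht1 ht2
  exact le_gsc_iff.mpr ⟨ht1, ht2⟩

end Isol

/-- Registered one-line form (carrier `norm_sub_le_two_mul_sce12` of the crux item) of `norm_sub_le_two_mul`. [folklore] -/
theorem norm_sub_le_two_mul_sce12 : open Literature.Geometry.Lorentzian in ∀ (f : ℝ → E3), Differentiable ℝ f → ∀ (T : ℝ), (∀ t, T ≤ t → ‖deriv f t‖ ≤ 2) → ∀ (s s' : ℝ), T ≤ s → T ≤ s' → ‖f s - f s'‖ ≤ 2 * |s - s'| :=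
  fun _ hd _ hb _ _ hs hs' ↦ norm_sub_le_two_mul hd hb hs hs'

end Summit.FinalStateConjecture.FinalStateConjecture.Theorems.SublinearIsFree.Staircase

end
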